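import Summits.HodgeConjecture.HodgeConjecture.Theorems.F0P3cStCharTSWeylHypJacobianClose   -- ★ p852061 (this seat) (J6) FILE 4 «CLOSE MODULO (T4)» `tubeJacobianLocal_of_modulusTransport`
import Summits.HodgeConjecture.HodgeConjecture.Theorems.F0P3cStCharTSModulusTransport       -- ★ p852043 (LH5-p03 g7) (T4) «MODULUS TRANSPORT» `model_twist_mul_twist_rev_eq_vanDijkWeight_re_sq`
import Summits.HodgeConjecture.HodgeConjecture.Theorems.F0P3cStCharTSWeylHypJacobianLocal    -- ★ p851645 (this seat's lineage) LOCAL SOCKET `lintegral_hypSet_eq_of_tubeJacobian_local`, `integral_hypSet_eq_of_tubeJacobian_local`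
import HarnessLib

/-!
# F0 · P3c · line LH6 «StCharTS» — ROAD «JAC-LOC» brick (J6) FILE 5 «★ CLOSED»: the local tube Jacobian of `U(Φ₃)(L⁺_v)` on the split torus IS `(Re Δ)² = D_G²`,
# UNCONDITIONALLY — and the weighted Weyl integration formula on the hyperbolic set with van Dijk's weight (Harish-Chandra 1970, Lemma 22; van Dijk 1972, §2)

Cell `pub/hodgecm-mathlib`, crux H413 = `stmt-HodgeConjecture-24833` (lane `--supports`, helper); seat LH6-p04 (g6); closes ROAD «JAC-LOC» of LH6-p03 (g5∕g6) (memo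
`F0/P3b/LH6-p03/g5/ROAD-JAC-LOC.v3.LH6p03g5.md`).  THEOREMS ONLY; sorry-free; no definition ∕ instance ∕ notation ∕ named-fact hypothesis; axioms TRIO.  HONEST LABEL:
count-neutral, closes no organ by itself (it discharges the `hJac`∕`hJacLoc` input of the Weyl-integration consumers); HC_CM is proved only modulo the 7 printed citations
(2 remaining: hLiu418 = `stmt-HodgeConjecture-24832`, h413 = `stmt-HodgeConjecture-24833`) until rung 0 closes.

WHAT.  `G = U(Φ₃)(L⁺_v)` (`v` non-split: `hns`), `T = (cmBorelTriple L 3 v).M` its split torus, `ν` a Haar measure, `tm` a Haar measure of `T`, `Φ(q, t) = q t q⁻¹`,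
`μ₀ = ν ∕ tm` (`quotientMeasure`), `w` the Weyl element, `Ω = ⋃_g g T^{reg} g⁻¹` the hyperbolic set, `Δ` = ★ `F0P3cStCharTSTorusDefs.vanDijkWeight` (so `(Re Δ)² = D_G²`,
★ (J7) ∕ ★ DG-FIELD `DG_coe_torus_eq_vanDijkWeight_re`).
* **`tubeJacobianLocal_vanDijkWeight_sq`** — for ANY weight `D : T → ℝ≥0` with `(D t : ℝ) = (Re Δ(t))²`: the `hJacLoc` clause of ★ p851645 VERBATIM (binders = ★ p851645's;
  no model object in the interface).  PROOF: ★ (J6) FILE 4 `tubeJacobianLocal_of_modulusTransport` at any place `w′ ∣ v` (Mathlib `Nonempty (PlacesOver L v)`, `hns w′`),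
  Borel σ-algebras and `Invertible 2` (characteristic `0`) chosen on the model, and its single hypothesis `hT4` DISCHARGED by ★ (T4) `model_twist_mul_twist_rev_eq_vanDijkWeight_re_sq`
  (the model writing `dw` of `hT4` is forced to be `(d i)(w′)` by ★ `glDiagonal_eval_eq_localNonsplitEquiv` and injectivity of `glDiagonal`, ★ `coe_glDiagonal`).
* **`lintegral_hypSet_vanDijkWeight_sq`** ∕ **`integral_hypSet_vanDijkWeight_sq`** — ★ p851645 `lintegral_hypSet_eq_of_tubeJacobian_local` ∕ `integral_hypSet_eq_of_tubeJacobian_local` with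
  `hJacLoc` discharged: **`2 · ∫⁻_Ω f dν = ∫⁻_{T^{reg}} D · ∫⁻_{G⧸T} f(Φ(q,t)) dμ₀ dtm`** for Borel `f ≥ 0`, and the Bochner form for `g` integrable on `Ω`, for every measurable such `D`.

## References
* [HarishChandra1970] Harish-Chandra, *Harmonic analysis on reductive p-adic groups*, LNM 162 (1970), Lemma 22, Lemma 42.
* [vanDijk1972] G. van Dijk, *Computation of certain induced characters of p-adic groups*, Math. Ann. 199 (1972), §2.
* [Rogawski1990] J. D. Rogawski, *Automorphic Representations of Unitary Groups in Three Variables*, Ann. of Math. Stud. 123 (1990), §12.5 p. 182; §4.9 p. 55.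
* [Weil1965] A. Weil, *L'intégration dans les groupes topologiques et ses applications*, 2e éd. (1965), n° 49 Lemme 22 (p. 70) [context locator of ★ p851645].
-/

set_option autoImplicit false
set_option linter.dupNamespace false

noncomputable section

open MeasureTheory Measure Set Filter Topology Function NumberField IsDedekindDomain Matrix
open Literature.MeasureTheory.Group
open Literature.NumberTheory Literature.NumberTheory.Automorphic Literature.NumberTheory.Automorphic.UnitaryGroup Literature.NumberTheory.Rogawski1990
open Summit.HodgeConjecture.HodgeConjecture.Cruxes.H413
open Summit.HodgeConjecture.HodgeConjecture.Cruxes.H413.F0P3cStCharTSWeylHypJacobianClose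
open Summit.HodgeConjecture.HodgeConjecture.Cruxes.H413.F0P3cStCharTSWeylHypJacobianLocal
open Summit.HodgeConjecture.HodgeConjecture.Cruxes.H413.F0P3cStCharTSModulusTransport
open Summit.HodgeConjecture.HodgeConjecture.Cruxes.H413.F0P3cStCharTSTubeModelTransport
open scoped ENNReal NNReal MatrixGroups Pointwise

namespace Summit.HodgeConjecture.HodgeConjecture.Cruxes.H413.F0P3cStCharTSWeylHypJacobianWeight

section CM

variable (L : Type) [Field L] [NumberField L] [IsCMField L] (v : HeightOneSpectrum (𝓞 ↥(maximalRealSubfield L)))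

set_option maxHeartbeats 3200000 in
set_option synthInstance.maxHeartbeats 400000 in
-- the (J6) FILE 4 instantiation on the model at `w′` (class of ★ (J6-M) ∕ ★ (T4))
/-- **(J6) ★ «JAC-LOC CLOSED» — THE LOCAL TUBE JACOBIAN IS `(Re Δ)² = D_G²`, UNCONDITIONALLY.**  For any weight `D : T → ℝ≥0` with `(D t : ℝ) = (Re Δ(t))²`, the
`hJacLoc` clause of ★ p851645 (verbatim): every regular `t₀ ∈ T` has an open `U ∋ t₀` and a measurable `A₀ ⊆ G⧸T` with `0 < μ₀(A₀) < ∞` such that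
`ν(Φ(A₀ × V)) = μ₀(A₀) · ∫⁻_V D dtm` for every measurable `W`-free regular `V ⊆ U` — module docstring.
[cite: HarishChandra1970, Lemma 22; Lemma 42] [cite: vanDijk1972, §2] [cite: Rogawski1990, §12.5 p. 182] -/
theorem tubeJacobianLocal_vanDijkWeight_sq
    (hns : ∀ w : PlacesOver L v, IsCMField.complexConj L • w.1 = w.1)
    [MeasurableSpace ↥(unitaryGroupOfForm (conjLocal L (IsCMField.complexConj L) v) (cmLocalForm L 3 v))] [BorelSpace ↥(unitaryGroupOfForm (conjLocal L (IsCMField.complexConj L) v) (cmLocalForm L 3 v))] [LocallyCompactSpace ↥(unitaryGroupOfForm (conjLocal L (IsCMField.complexConj L) v) (cmLocalForm L 3 v))] [SecondCountableTopology ↥(unitaryGroupOfForm (conjLocal L (IsCMField.complexConj L) v) (cmLocalForm L 3 v))] [T2Space ↥(unitaryGroupOfForm (conjLocal L (IsCMField.complexConj L) v) (cmLocalForm L 3 v))]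
    [MeasurableSpace (↥(unitaryGroupOfForm (conjLocal L (IsCMField.complexConj L) v) (cmLocalForm L 3 v)) ⧸ (cmBorelTriple L 3 v).M)] [BorelSpace (↥(unitaryGroupOfForm (conjLocal L (IsCMField.complexConj L) v) (cmLocalForm L 3 v)) ⧸ (cmBorelTriple L 3 v).M)]
    (ν : Measure ↥(unitaryGroupOfForm (conjLocal L (IsCMField.complexConj L) v) (cmLocalForm L 3 v))) [ν.IsHaarMeasure] [ν.IsMulRightInvariant]
    (tm : Measure ↥(cmBorelTriple L 3 v).M) [tm.IsMulLeftInvariant] [IsFiniteMeasureOnCompacts tm] [tm.IsOpenPosMeasure] [tm.IsInvInvariant]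
    (Φ : (↥(unitaryGroupOfForm (conjLocal L (IsCMField.complexConj L) v) (cmLocalForm L 3 v)) ⧸ (cmBorelTriple L 3 v).M) × ↥(cmBorelTriple L 3 v).M → ↥(unitaryGroupOfForm (conjLocal L (IsCMField.complexConj L) v) (cmLocalForm L 3 v))) (hΦ : ∀ (x : ↥(unitaryGroupOfForm (conjLocal L (IsCMField.complexConj L) v) (cmLocalForm L 3 v))) (t : ↥(cmBorelTriple L 3 v).M), Φ (QuotientGroup.mk x, t) = x * t * x⁻¹)
    (w : ↥(unitaryGroupOfForm (conjLocal L (IsCMField.complexConj L) v) (cmLocalForm L 3 v))) (hw : Units.val (w : GL (Fin 3) (LocalRing L v)) = cmLocalForm L 3 v)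
    (D : ↥(cmBorelTriple L 3 v).M → ℝ≥0) (hD : ∀ t : ↥(cmBorelTriple L 3 v).M, (D t : ℝ) = ((F0P3cStCharTSTorusDefs.vanDijkWeight L v t).re) ^ 2) :
    ∀ t₀ : ↥(cmBorelTriple L 3 v).M, IsRegularElt (((t₀ : ↥(unitaryGroupOfForm (conjLocal L (IsCMField.complexConj L) v) (cmLocalForm L 3 v)))) : GL (Fin 3) (LocalRing L v)) →
      ∃ U : Set ↥(cmBorelTriple L 3 v).M, IsOpen U ∧ t₀ ∈ U ∧
        ∃ A₀ : Set (↥(unitaryGroupOfForm (conjLocal L (IsCMField.complexConj L) v) (cmLocalForm L 3 v)) ⧸ (cmBorelTriple L 3 v).M), MeasurableSet A₀ ∧ (quotientMeasure (cmBorelTriple L 3 v).M tm (isClosed_cmBorelTriple_M L v) ν) A₀ ≠ 0 ∧ (quotientMeasure (cmBorelTriple L 3 v).M tm (isClosed_cmBorelTriple_M L v) ν) A₀ ≠ ∞ ∧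
          ∀ V : Set ↥(cmBorelTriple L 3 v).M, MeasurableSet V → V ⊆ U → (∀ t ∈ V, IsRegularElt (((t : ↥(unitaryGroupOfForm (conjLocal L (IsCMField.complexConj L) v) (cmLocalForm L 3 v)))) : GL (Fin 3) (LocalRing L v))) →
            (∀ t ∈ V, ∀ t' ∈ V, ((t' : ↥(cmBorelTriple L 3 v).M) : ↥(unitaryGroupOfForm (conjLocal L (IsCMField.complexConj L) v) (cmLocalForm L 3 v))) ≠ w * t * w⁻¹) →
              ν (Φ '' (A₀ ×ˢ V)) = (quotientMeasure (cmBorelTriple L 3 v).M tm (isClosed_cmBorelTriple_M L v) ν) A₀ * ∫⁻ t in V, (D t : ℝ≥0∞) ∂tm := by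
  classical
  obtain ⟨w'⟩ := (inferInstance : Nonempty (PlacesOver L v))
  letI : MeasurableSpace ↥(unitaryGroupOfForm (galAdicCompletionMap (L := L) (IsCMField.complexConj L) (hns w')) (placeForm (Rogawski1990.qsForm L) w'.1)) := borel _
  haveI : BorelSpace ↥(unitaryGroupOfForm (galAdicCompletionMap (L := L) (IsCMField.complexConj L) (hns w')) (placeForm (Rogawski1990.qsForm L) w'.1)) := ⟨rfl⟩
  letI : MeasurableSpace (w'.1.adicCompletion L) := borel _
  haveI : BorelSpace (w'.1.adicCompletion L) := ⟨rfl⟩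
  haveI : CharZero (w'.1.adicCompletion L) := charZero_of_injective_algebraMap (algebraMap (L : Type) (w'.1.adicCompletion L)).injective
  letI : Invertible (2 : (w'.1.adicCompletion L)) := invertibleOfNonzero two_ne_zero
  refine tubeJacobianLocal_of_modulusTransport L v hns ν tm Φ hΦ w hw D hD w' (hns w') ?_
  intro s hregs d hd t sw ht dw _ hdt hdsw hregt hregsw
  -- the model writing is forced: `dw i = (d i)(w′)`
  have hdd : glDiagonal 3 (w'.1.adicCompletion L) dw =
      glDiagonal 3 (w'.1.adicCompletion L) (fun i => Units.map (Pi.evalRingHom (fun w'' : PlacesOver L v => w''.1.adicCompletion L) w').toMonoidHom (d i)) := by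
    rw [hdt, ht, glDiagonal_eval_eq_localNonsplitEquiv L v w' (hns w') _ hd]
  have hdw : ∀ i, dw i = Units.map (Pi.evalRingHom (fun w'' : PlacesOver L v => w''.1.adicCompletion L) w').toMonoidHom (d i) := fun i => by
    apply Units.ext
    have h := congrArg (fun g : GL (Fin 3) (w'.1.adicCompletion L) => (g : Matrix (Fin 3) (Fin 3) (w'.1.adicCompletion L)) i i) hdd
    simpa only [coe_glDiagonal, Matrix.diagonal_apply_eq] using h
  -- ★ (T4), read in `ℝ` (its right-hand side `⟨(Re Δ(s))², _⟩` coerces to `(Re Δ(s))²` by `rfl`)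
  have h := congrArg NNReal.toReal
    (model_twist_mul_twist_rev_eq_vanDijkWeight_re_sq L v w' (hns w') hns w hw s hregs hd dw hdw t sw hdt hdsw hregt hregsw)
  rw [NNReal.coe_mul] at h
  exact h

set_option maxHeartbeats 1600000 in
set_option synthInstance.maxHeartbeats 200000 in
-- instance-term unification on the CM local carrier, as in ★ p851645
/-- **WEIGHTED WEYL INTEGRATION FORMULA ON THE HYPERBOLIC SET with van Dijk's weight** (`lintegral` form): for every measurable `D : T → ℝ≥0` with
`(D t : ℝ) = (Re Δ(t))²` and every Borel `f ≥ 0`, `2 · ∫⁻_Ω f dν = ∫⁻_{T^{reg}} D(t) · ∫⁻_{G⧸T} f(Φ(q, t)) dμ₀(q) dtm(t)` — ★ p851645 `lintegral_hypSet_eq_of_tubeJacobian_local`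
with `hJacLoc` discharged by `tubeJacobianLocal_vanDijkWeight_sq`.
[cite: HarishChandra1970, Lemma 22; Lemma 42] [cite: vanDijk1972, §2] [cite: Rogawski1990, §12.5 p. 182] [cite: Weil1965, n° 49 Lemme 22 (p. 70)] -/
theorem lintegral_hypSet_vanDijkWeight_sq
    (hns : ∀ w : PlacesOver L v, IsCMField.complexConj L • w.1 = w.1)
    [MeasurableSpace ↥(unitaryGroupOfForm (conjLocal L (IsCMField.complexConj L) v) (cmLocalForm L 3 v))] [BorelSpace ↥(unitaryGroupOfForm (conjLocal L (IsCMField.complexConj L) v) (cmLocalForm L 3 v))] [LocallyCompactSpace ↥(unitaryGroupOfForm (conjLocal L (IsCMField.complexConj L) v) (cmLocalForm L 3 v))] [SecondCountableTopology ↥(unitaryGroupOfForm (conjLocal L (IsCMField.complexConj L) v) (cmLocalForm L 3 v))] [T2Space ↥(unitaryGroupOfForm (conjLocal L (IsCMField.complexConj L) v) (cmLocalForm L 3 v))]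
    [MeasurableSpace (↥(unitaryGroupOfForm (conjLocal L (IsCMField.complexConj L) v) (cmLocalForm L 3 v)) ⧸ (cmBorelTriple L 3 v).M)] [BorelSpace (↥(unitaryGroupOfForm (conjLocal L (IsCMField.complexConj L) v) (cmLocalForm L 3 v)) ⧸ (cmBorelTriple L 3 v).M)]
    (ν : Measure ↥(unitaryGroupOfForm (conjLocal L (IsCMField.complexConj L) v) (cmLocalForm L 3 v))) [ν.IsHaarMeasure] [ν.IsMulRightInvariant]
    (tm : Measure ↥(cmBorelTriple L 3 v).M) [tm.IsMulLeftInvariant] [IsFiniteMeasureOnCompacts tm] [tm.IsOpenPosMeasure] [tm.IsInvInvariant]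
    (Φ : (↥(unitaryGroupOfForm (conjLocal L (IsCMField.complexConj L) v) (cmLocalForm L 3 v)) ⧸ (cmBorelTriple L 3 v).M) × ↥(cmBorelTriple L 3 v).M → ↥(unitaryGroupOfForm (conjLocal L (IsCMField.complexConj L) v) (cmLocalForm L 3 v))) (hΦ : ∀ (x : ↥(unitaryGroupOfForm (conjLocal L (IsCMField.complexConj L) v) (cmLocalForm L 3 v))) (t : ↥(cmBorelTriple L 3 v).M), Φ (QuotientGroup.mk x, t) = x * t * x⁻¹)
    (w : ↥(unitaryGroupOfForm (conjLocal L (IsCMField.complexConj L) v) (cmLocalForm L 3 v))) (hw : Units.val (w : GL (Fin 3) (LocalRing L v)) = cmLocalForm L 3 v)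
    (D : ↥(cmBorelTriple L 3 v).M → ℝ≥0) (hDm : Measurable D) (hD : ∀ t : ↥(cmBorelTriple L 3 v).M, (D t : ℝ) = ((F0P3cStCharTSTorusDefs.vanDijkWeight L v t).re) ^ 2) :
    ∀ f : ↥(unitaryGroupOfForm (conjLocal L (IsCMField.complexConj L) v) (cmLocalForm L 3 v)) → ℝ≥0∞, Measurable f →
      2 * ∫⁻ y in {x | ∃ g t : ↥(unitaryGroupOfForm (conjLocal L (IsCMField.complexConj L) v) (cmLocalForm L 3 v)), t ∈ (cmBorelTriple L 3 v).M ∧ IsRegularElt (t : GL (Fin 3) (LocalRing L v)) ∧ g * t * g⁻¹ = x}, f y ∂ν =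
        ∫⁻ t in {t : ↥(cmBorelTriple L 3 v).M | IsRegularElt (((t : ↥(unitaryGroupOfForm (conjLocal L (IsCMField.complexConj L) v) (cmLocalForm L 3 v)))) : GL (Fin 3) (LocalRing L v))}, (D t : ℝ≥0∞) * ∫⁻ q, f (Φ (q, t)) ∂(quotientMeasure (cmBorelTriple L 3 v).M tm (isClosed_cmBorelTriple_M L v) ν) ∂tm :=
  lintegral_hypSet_eq_of_tubeJacobian_local L v hns ν tm Φ hΦ w hw D hDm (tubeJacobianLocal_vanDijkWeight_sq L v hns ν tm Φ hΦ w hw D hD)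

set_option maxHeartbeats 1600000 in
set_option synthInstance.maxHeartbeats 200000 in
-- instance-term unification on the CM local carrier, as in ★ p851645
/-- **WEIGHTED WEYL INTEGRATION FORMULA ON THE HYPERBOLIC SET with van Dijk's weight** (Bochner form): for every measurable `D : T → ℝ≥0` with `(D t : ℝ) = (Re Δ(t))²`
and every `g : G → ℂ` integrable on `Ω`: `(t, q) ↦ g(Φ(q, t))` is integrable for `(D · tm|_{T^{reg}}) ⊗ μ₀` and `∫_{T^{reg}} D(t) • ∫_{G⧸T} g(Φ(q,t)) dμ₀ dtm = 2 • ∫_Ω g dν` —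
★ p851645 `integral_hypSet_eq_of_tubeJacobian_local` with `hJacLoc` discharged by `tubeJacobianLocal_vanDijkWeight_sq`.
[cite: HarishChandra1970, Lemma 22; Lemma 42] [cite: vanDijk1972, §2] [cite: Rogawski1990, §12.5 p. 182] [cite: Weil1965, n° 49 Lemme 22 (p. 70)] -/
theorem integral_hypSet_vanDijkWeight_sq
    (hns : ∀ w : PlacesOver L v, IsCMField.complexConj L • w.1 = w.1)
    [MeasurableSpace ↥(unitaryGroupOfForm (conjLocal L (IsCMField.complexConj L) v) (cmLocalForm L 3 v))] [BorelSpace ↥(unitaryGroupOfForm (conjLocal L (IsCMField.complexConj L) v) (cmLocalForm L 3 v))] [LocallyCompactSpace ↥(unitaryGroupOfForm (conjLocal L (IsCMField.complexConj L) v) (cmLocalForm L 3 v))] [SecondCountableTopology ↥(unitaryGroupOfForm (conjLocal L (IsCMField.complexConj L) v) (cmLocalForm L 3 v))] [T2Space ↥(unitaryGroupOfForm (conjLocal L (IsCMField.complexConj L) v) (cmLocalForm L 3 v))]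
    [MeasurableSpace (↥(unitaryGroupOfForm (conjLocal L (IsCMField.complexConj L) v) (cmLocalForm L 3 v)) ⧸ (cmBorelTriple L 3 v).M)] [BorelSpace (↥(unitaryGroupOfForm (conjLocal L (IsCMField.complexConj L) v) (cmLocalForm L 3 v)) ⧸ (cmBorelTriple L 3 v).M)]
    (ν : Measure ↥(unitaryGroupOfForm (conjLocal L (IsCMField.complexConj L) v) (cmLocalForm L 3 v))) [ν.IsHaarMeasure] [ν.IsMulRightInvariant]
    (tm : Measure ↥(cmBorelTriple L 3 v).M) [tm.IsMulLeftInvariant] [IsFiniteMeasureOnCompacts tm] [tm.IsOpenPosMeasure] [tm.IsInvInvariant]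
    (Φ : (↥(unitaryGroupOfForm (conjLocal L (IsCMField.complexConj L) v) (cmLocalForm L 3 v)) ⧸ (cmBorelTriple L 3 v).M) × ↥(cmBorelTriple L 3 v).M → ↥(unitaryGroupOfForm (conjLocal L (IsCMField.complexConj L) v) (cmLocalForm L 3 v))) (hΦ : ∀ (x : ↥(unitaryGroupOfForm (conjLocal L (IsCMField.complexConj L) v) (cmLocalForm L 3 v))) (t : ↥(cmBorelTriple L 3 v).M), Φ (QuotientGroup.mk x, t) = x * t * x⁻¹)
    (w : ↥(unitaryGroupOfForm (conjLocal L (IsCMField.complexConj L) v) (cmLocalForm L 3 v))) (hw : Units.val (w : GL (Fin 3) (LocalRing L v)) = cmLocalForm L 3 v)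
    (D : ↥(cmBorelTriple L 3 v).M → ℝ≥0) (hDm : Measurable D) (hD : ∀ t : ↥(cmBorelTriple L 3 v).M, (D t : ℝ) = ((F0P3cStCharTSTorusDefs.vanDijkWeight L v t).re) ^ 2)
    (g : ↥(unitaryGroupOfForm (conjLocal L (IsCMField.complexConj L) v) (cmLocalForm L 3 v)) → ℂ) (hg : IntegrableOn g {x | ∃ g t : ↥(unitaryGroupOfForm (conjLocal L (IsCMField.complexConj L) v) (cmLocalForm L 3 v)), t ∈ (cmBorelTriple L 3 v).M ∧ IsRegularElt (t : GL (Fin 3) (LocalRing L v)) ∧ g * t * g⁻¹ = x} ν) :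
    Integrable (fun p : ↥(cmBorelTriple L 3 v).M × (↥(unitaryGroupOfForm (conjLocal L (IsCMField.complexConj L) v) (cmLocalForm L 3 v)) ⧸ (cmBorelTriple L 3 v).M) => g (Φ (p.2, p.1)))
        (((tm.restrict {t : ↥(cmBorelTriple L 3 v).M | IsRegularElt (((t : ↥(unitaryGroupOfForm (conjLocal L (IsCMField.complexConj L) v) (cmLocalForm L 3 v)))) : GL (Fin 3) (LocalRing L v))}).withDensity fun t => (D t : ℝ≥0∞)).prod (quotientMeasure (cmBorelTriple L 3 v).M tm (isClosed_cmBorelTriple_M L v) ν)) ∧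
      ∫ t in {t : ↥(cmBorelTriple L 3 v).M | IsRegularElt (((t : ↥(unitaryGroupOfForm (conjLocal L (IsCMField.complexConj L) v) (cmLocalForm L 3 v)))) : GL (Fin 3) (LocalRing L v))}, (D t : ℝ) • ∫ q, g (Φ (q, t)) ∂(quotientMeasure (cmBorelTriple L 3 v).M tm (isClosed_cmBorelTriple_M L v) ν) ∂tm =
        (2 : ℝ) • ∫ y in {x | ∃ g t : ↥(unitaryGroupOfForm (conjLocal L (IsCMField.complexConj L) v) (cmLocalForm L 3 v)), t ∈ (cmBorelTriple L 3 v).M ∧ IsRegularElt (t : GL (Fin 3) (LocalRing L v)) ∧ g * t * g⁻¹ = x}, g y ∂ν :=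
  integral_hypSet_eq_of_tubeJacobian_local L v hns ν tm Φ hΦ w hw D hDm (tubeJacobianLocal_vanDijkWeight_sq L v hns ν tm Φ hΦ w hw D hD) g hg

end CM

end Summit.HodgeConjecture.HodgeConjecture.Cruxes.H413.F0P3cStCharTSWeylHypJacobianWeight

end
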